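import Mathlib.RingTheory.WittVector.Teichmuller
import Mathlib.RingTheory.WittVector.DiscreteValuationRing
import Mathlib.NumberTheory.Padics.RingHoms
import Mathlib.Analysis.Normed.Ring.Units
import Literature.AnabelianGeometry.AbsoluteAnabelian.GeneralizedSubpadicCyclotomicProofs
import HarnessLib

/-!
# Sharpness of "the prime `p` clearly serves as a prime `l`": over `Frac W(𝔽̄_p)` every `l`-adic
# cyclotomic character with `l ≠ p` is TRIVIAL, proof-only

Authors: abc-iut-L4-t13 (gen 2).

Companion (theorems only) of `GeneralizedSubpadicCyclotomicProofs.lean`, which proves that for a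
generalized sub-`p`-adic field `k` ([Tpcs] Def 4.11 p. 44) the `p`-adic cyclotomic character has open
image ([AbsTopI] Ex 4.8 (i) p. 58: "the prime `p` clearly serves as a prime “`l`” as in the statement
of Theorem 4.7").  Here the complementary NEGATIVE statement showing that print's choice of `p` is
forced: the field `F = Frac W(𝔽̄_p)` — the smallest generalized sub-`p`-adic field
(`AbsTopIII.isGeneralizedSubpadicFor_fracWitt`, abc-iut-L4-d1, `KummerFaithfulGenSubpadicProofs.lean`) — contains all roots of unity of order prime to `p` (Teichmüller
representatives of `𝔽̄_p^×`, `exists_isPrimitiveRoot_fracWitt`), so for a prime `l ≠ p` its `l`-adic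
cyclotomic character is identically `1` (`cyclotomicChar_fracWitt_eq_one`) and in particular does NOT
have open image (`not_isOpen_range_cyclotomicChar_fracWitt`).  Consequently the hypothesis "for some
`l ∈ Σ`, the cyclotomic character `G → ℤ_l^×` has open image" of [AbsTopI] Lemma 4.5 / Thm 4.7 (b) /
[AbsTopII] Cor 3.3 / 3.7 can, for generalized sub-`p`-adic base fields, in general ONLY be witnessed by
`l = p` (contrast: for sub-`p`-adic fields every prime works, `AbsTopIII.IsSubpadic.isOpen_range_cyclotomicChar`),
and two such fields for different primes `p₁ ≠ p₂` need not admit a common witness (as Cor 3.4 / 3.8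
require).  This is the cyclotomic shadow of [AbsTopIII] Rmk 1.5.4 (iv) p. 34 ("generalized
sub-`p`-adic fields [...] are not, in general, torally Kummer-faithful", `AbsTopIII.Rmk_1_5_4_iv_holds`).

General lemma: `cyclotomicChar_eq_one_of_forall_isPrimitiveRoot` — if a field contains primitive
`l^n`-th roots of unity for every `n`, its `l`-adic cyclotomic character is trivial (the trunk's
`cyclotomicCharacter_eq_one_of_forall_pow_eq_one`).

HONEST FRAMING: classical facts about OUR definitions (`cyclotomicChar`, `IsGeneralizedSubpadicFor`);
a witness of SHARPNESS of a typed hypothesis, not a refutation of any typed statement; nothing here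
bears on [IUTchIII] Cor 3.12.  Proof-only, no definitions.
-/

noncomputable section

open Polynomial

namespace Literature.AnabelianGeometry.AbsoluteAnabelian.AbsTopIII

open Literature.NumberTheory.GaloisRepresentations

universe u

/-- If a field `k` contains a primitive `l^n`-th root of unity for EVERY `n`, then its `l`-adic
cyclotomic character `χ_l : G_k → ℤ_l^×` is trivial: every `l`-power root of unity of `k̄` is a power
of one coming from `k`, hence fixed by `G_k` (trunk: `cyclotomicCharacter_eq_one_of_forall_pow_eq_one`).
The degenerate case excluded by [AbsTopI] Lemma 4.5's hypothesis "the cyclotomic character [...] has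
open image" (p. 54). [cite: MochizukiAbsTopI2012, Lemma 4.5 p.54] -/
theorem cyclotomicChar_eq_one_of_forall_isPrimitiveRoot {k : Type u} [Field k] {l : ℕ}
    [hl : Fact l.Prime] (h : ∀ n : ℕ, ∃ ζ : k, IsPrimitiveRoot ζ (l ^ n))
    (σ : Field.absoluteGaloisGroup k) : cyclotomicChar k l σ = 1 := by
  change cyclotomicCharacter (AlgebraicClosure k) l
    (Field.absoluteGaloisGroup.toAlgEquiv k σ).toRingEquiv = 1
  refine cyclotomicCharacter_eq_one_of_forall_pow_eq_one l _ fun n t ht => ?_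
  obtain ⟨ζ, hζ⟩ := h n
  have hζ' : IsPrimitiveRoot (algebraMap k (AlgebraicClosure k) ζ) (l ^ n) :=
    hζ.map_of_injective (algebraMap k (AlgebraicClosure k)).injective
  obtain ⟨i, -, rfl⟩ := hζ'.eq_pow_of_pow_eq_one ht
  change (Field.absoluteGaloisGroup.toAlgEquiv k σ) (algebraMap k (AlgebraicClosure k) ζ ^ i) = _
  rw [map_pow, AlgEquiv.commutes]

/-- `𝔽̄_p` has primitive `m`-th roots of unity for every `m` prime to `p`; hence so does `W(𝔽̄_p)`
(Teichmüller representatives, Mathlib `WittVector.teichmuller`, a MONOID homomorphism, injective by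
`WittVector.teichmuller_coeff_zero`) and its fraction field `F = Frac W(𝔽̄_p)` — the base field of
[Tpcs] Def 4.11 p. 44. [cite: MochizukiTopics2003, Def 4.11 p.44] -/
theorem exists_isPrimitiveRoot_fracWitt (p : ℕ) [hp : Fact p.Prime] {m : ℕ} (hm : ¬ p ∣ m) :
    ∃ ζ : FractionRing (WittVector p (AlgebraicClosure (ZMod p))), IsPrimitiveRoot ζ m := by
  -- a primitive `m`-th root of unity in `𝔽̄_p`
  haveI : NeZero ((m : ℕ) : AlgebraicClosure (ZMod p)) := by
    refine ⟨fun h => hm ?_⟩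
    have h' : algebraMap (ZMod p) (AlgebraicClosure (ZMod p)) (m : ZMod p) = 0 := by
      rwa [map_natCast]
    rw [map_eq_zero_iff _ (algebraMap (ZMod p) (AlgebraicClosure (ZMod p))).injective,
      ZMod.natCast_eq_zero_iff] at h'
    exact h'
  obtain ⟨ζ₀, hζ₀⟩ := HasEnoughRootsOfUnity.exists_primitiveRoot (AlgebraicClosure (ZMod p)) m
  -- its Teichmüller lift, then its image in the fraction field
  have hinj : Function.Injective
      (WittVector.teichmuller p : AlgebraicClosure (ZMod p) →* WittVector p (AlgebraicClosure (ZMod p))) :=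
    fun a b hab => by
      have := congrArg (fun x : WittVector p (AlgebraicClosure (ZMod p)) => x.coeff 0) hab
      simpa [WittVector.teichmuller_coeff_zero] using this
  have h1 : IsPrimitiveRoot (WittVector.teichmuller p ζ₀) m := hζ₀.map_of_injective hinj
  exact ⟨_, h1.map_of_injective
    (IsFractionRing.injective (WittVector p (AlgebraicClosure (ZMod p)))
      (FractionRing (WittVector p (AlgebraicClosure (ZMod p)))))⟩

/-- **For `l ≠ p` the `l`-adic cyclotomic character of `Frac W(𝔽̄_p)` is trivial** — so in
[AbsTopI] Ex 4.8 (i) p. 58 ("the prime `p` clearly serves as a prime “`l`”") no prime other than `p`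
can serve in general. [cite: MochizukiAbsTopI2012, Ex 4.8 (i) p.58] -/
theorem cyclotomicChar_fracWitt_eq_one (p l : ℕ) [Fact p.Prime] [hl : Fact l.Prime] (hlp : l ≠ p)
    (σ : Field.absoluteGaloisGroup (FractionRing (WittVector p (AlgebraicClosure (ZMod p))))) :
    cyclotomicChar (FractionRing (WittVector p (AlgebraicClosure (ZMod p)))) l σ = 1 := by
  refine cyclotomicChar_eq_one_of_forall_isPrimitiveRoot (fun n => ?_) σ
  refine exists_isPrimitiveRoot_fracWitt p (m := l ^ n) fun h => hlp ?_
  exact ((Nat.prime_dvd_prime_iff_eq (Fact.out) hl.out).mp ((Fact.out : p.Prime).dvd_of_dvd_pow h)).symm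

/-- The singleton `{1}` is not open in `ℤ_l^×` (`1 + l^n → 1`; `Units.val` is an open embedding for
the complete normed ring `ℤ_l`). [folklore] -/
private theorem not_isOpen_singleton_one_units_padicInt (l : ℕ) [hl : Fact l.Prime] :
    ¬ IsOpen ({1} : Set ℤ_[l]ˣ) := by
  intro h
  have h1 : IsOpen ((Units.val : ℤ_[l]ˣ → ℤ_[l]) '' {1}) := Units.isOpenEmbedding_val.isOpenMap _ h
  rw [Set.image_singleton, Units.val_one, Metric.isOpen_singleton_iff] at h1
  obtain ⟨ε, hε, hball⟩ := h1
  -- `l^n` is small but `1 + l^n ≠ 1`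
  obtain ⟨n, hn⟩ := exists_pow_lt_of_lt_one hε
    (show ((l : ℝ))⁻¹ < 1 from inv_lt_one_of_one_lt₀ (by exact_mod_cast hl.out.one_lt))
  have hdist : dist (1 + (l : ℤ_[l]) ^ n) 1 < ε := by
    rw [dist_eq_norm, add_sub_cancel_left, norm_pow, PadicInt.norm_p]
    exact hn
  have := hball _ hdist
  have h0 : (l : ℤ_[l]) ^ n = 0 := by simpa using this
  exact (pow_ne_zero n (by exact_mod_cast hl.out.ne_zero : (l : ℤ_[l]) ≠ 0)) h0

/-- **The `l`-adic cyclotomic character of `Frac W(𝔽̄_p)` does NOT have open image for `l ≠ p`**: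
the hypothesis "for some `l ∈ Σ`, the cyclotomic character `G → ℤ_l^×` has open image" of
[AbsTopII] Cor 3.7 p. 72 (in the generalized sub-`p`-adic generality of Rmk 3.7.1) is witnessed by
`l = p` (`IsGeneralizedSubpadicFor.isOpen_range_cyclotomicChar`) and in general by no other prime.
[cite: MochizukiAbsTopII2013, Rmk 3.7.1 p.73] -/
theorem not_isOpen_range_cyclotomicChar_fracWitt (p l : ℕ) [Fact p.Prime] [Fact l.Prime]
    (hlp : l ≠ p) :
    ¬ IsOpen (Set.range
      (cyclotomicChar (FractionRing (WittVector p (AlgebraicClosure (ZMod p)))) l)) := by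
  have hrange : Set.range
      (cyclotomicChar (FractionRing (WittVector p (AlgebraicClosure (ZMod p)))) l) = {1} := by
    ext x
    simp only [Set.mem_range, Set.mem_singleton_iff]
    constructor
    · rintro ⟨σ, rfl⟩; exact cyclotomicChar_fracWitt_eq_one p l hlp σ
    · rintro rfl; exact ⟨1, map_one _⟩
  rw [hrange]
  exact not_isOpen_singleton_one_units_padicInt l

/-- Hence "`χ_l` has open image for SOME prime `l`" and "`χ_p` has open image" are, over
`Frac W(𝔽̄_p)`, witnessed exactly at `l = p`: a prime `l` with `χ_l` open must equal `p`.
[cite: MochizukiAbsTopI2012, Ex 4.8 (i) p.58] -/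
theorem eq_of_isOpen_range_cyclotomicChar_fracWitt (p l : ℕ) [Fact p.Prime] [Fact l.Prime]
    (h : IsOpen (Set.range
      (cyclotomicChar (FractionRing (WittVector p (AlgebraicClosure (ZMod p)))) l))) : l = p := by
  by_contra hlp
  exact not_isOpen_range_cyclotomicChar_fracWitt p l hlp h

end Literature.AnabelianGeometry.AbsoluteAnabelian.AbsTopIII
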